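import Mathlib

/-!
# T5AdmissibilityBookkeeping — the elementary steps of N4.3 v12 (A2)–(A3)

Kernel witnesses (seat p5, cell pub-hodge-repro2, Tier 5) for the [P] bookkeeping of
`route/T5-N4-p5.md` v12, the print-status addendum closing G-N4.3.6:

* (A2)(i) «`G_∞ = Z_∞·G_∞^{ss}`: for `g` in a factor `U(p,q)` pick `z ∈ U(1)` with `z² = det g`;
  then `z⁻¹·g` has determinant 1» — `exists_unit_scalar_det_smul_eq_one` (for any `n ≥ 1` and any
  complex matrix of unimodular determinant: a unit scalar `z` with `det (z⁻¹ • g) = 1`);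
* (A2)(ii) «every closed `G_∞^{ss}`-invariant subspace is `G_∞`-invariant» and (A2)(iv) «the
  `K_∞`-span and the `K^{ss}`-span of any vector coincide» when the centre acts by scalars and
  `G = Z·H` — `submodule_stable_of_central`, `span_orbit_eq_of_central` (pure module theory for a
  representation `ρ : G →* (V →ₗ[ℂ] V)`, a subgroup `H` and a set `Z` of elements acting by scalars
  with `G = Z * H`);
* (A3) STEP 1 «the `G_∞`-orbits on the compact space `Y` are open, so there are finitely many, and
  each orbit is closed (complement of finitely many open orbits), hence compact» —
  `finite_of_pairwise_disjoint_open_cover` (a pairwise-disjoint cover of a compact space by non-empty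
  open sets is finite), `isClosed_of_pairwise_disjoint_open_cover`,
  `isCompact_of_pairwise_disjoint_open_cover`.

Nothing about Lie groups, unitary representations, Haar measures or adelic quotients is asserted;
these are the finite-dimensional / point-set facts the prose uses by name.
-/

namespace Summit.Ventures.HodgeRepro2.T5AdmissibilityBookkeeping

section ScalarDecomposition

open Matrix

/-- (A2)(i): a complex `n × n` matrix `g` with `‖det g‖ = 1` (`n ≥ 1`) is `z • g′` with `z` a unit
scalar and `det g′ = 1`: take an `n`-th root `z` of `det g`, then `g′ = z⁻¹ • g`. -/
theorem exists_unit_scalar_det_smul_eq_one {n : ℕ} (hn : 0 < n) (g : Matrix (Fin n) (Fin n) ℂ)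
    (hg : ‖g.det‖ = 1) : ∃ z : ℂ, ‖z‖ = 1 ∧ (z⁻¹ • g).det = 1 := by
  obtain ⟨z, hz⟩ := IsAlgClosed.exists_pow_nat_eq g.det hn
  have hz1 : ‖z‖ = 1 := by
    have : ‖z‖ ^ n = 1 := by rw [← norm_pow, hz, hg]
    exact (pow_eq_one_iff_of_nonneg (norm_nonneg z) hn.ne').mp this
  have hz0 : z ≠ 0 := by
    intro h
    rw [h, norm_zero] at hz1
    exact zero_ne_one hz1
  refine ⟨z, hz1, ?_⟩
  rw [det_smul, Fintype.card_fin, inv_pow, hz, inv_mul_cancel₀]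
  intro h
  rw [h, norm_zero] at hg
  exact zero_ne_one hg

/-- The scalar of `exists_unit_scalar_det_smul_eq_one` recovers `g`: `g = z • (z⁻¹ • g)`. -/
theorem smul_inv_smul_eq {n : ℕ} (g : Matrix (Fin n) (Fin n) ℂ) {z : ℂ} (hz : ‖z‖ = 1) :
    z • (z⁻¹ • g) = g := by
  have hz0 : z ≠ 0 := by
    intro h
    rw [h, norm_zero] at hz
    exact zero_ne_one hz
  rw [smul_smul, mul_inv_cancel₀ hz0, one_smul]

end ScalarDecomposition

section Central

variable {G : Type*} [Group G] {V : Type*} [AddCommGroup V] [Module ℂ V]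
variable (ρ : Representation ℂ G V) (H : Subgroup G) (Z : Set G)

/-- (A2)(ii): if every element of `Z` acts by a scalar and `G = Z * H`, then a submodule stable under
`H` is stable under all of `G`. -/
theorem submodule_stable_of_central (hZ : ∀ z ∈ Z, ∃ c : ℂ, ρ z = c • LinearMap.id)
    (hGH : ∀ g : G, ∃ z ∈ Z, ∃ h ∈ H, g = z * h) (W : Submodule ℂ V)
    (hW : ∀ h ∈ H, ∀ v ∈ W, ρ h v ∈ W) (g : G) (v : V) (hv : v ∈ W) : ρ g v ∈ W := by
  obtain ⟨z, hz, h, hh, rfl⟩ := hGH g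
  obtain ⟨c, hc⟩ := hZ z hz
  rw [map_mul, Module.End.mul_apply, hc, LinearMap.smul_apply, LinearMap.id_apply]
  exact W.smul_mem c (hW h hh v hv)

/-- (A2)(iv): under the same hypotheses the `G`-span and the `H`-span of any vector coincide
(«the `K_∞`-finite vectors are the `K^{ss}`-finite ones»). -/
theorem span_orbit_eq_of_central (hZ : ∀ z ∈ Z, ∃ c : ℂ, ρ z = c • LinearMap.id)
    (hGH : ∀ g : G, ∃ z ∈ Z, ∃ h ∈ H, g = z * h) (v : V) :
    Submodule.span ℂ (Set.range fun g : G => ρ g v) =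
      Submodule.span ℂ (Set.range fun h : H => ρ (h : G) v) := by
  apply le_antisymm
  · rw [Submodule.span_le]
    rintro _ ⟨g, rfl⟩
    obtain ⟨z, hz, h, hh, rfl⟩ := hGH g
    obtain ⟨c, hc⟩ := hZ z hz
    dsimp only
    rw [map_mul, Module.End.mul_apply, hc, LinearMap.smul_apply, LinearMap.id_apply]
    exact Submodule.smul_mem _ c (Submodule.subset_span ⟨⟨h, hh⟩, rfl⟩)
  · rw [Submodule.span_le]
    rintro _ ⟨h, rfl⟩
    exact Submodule.subset_span ⟨(h : G), rfl⟩

/-- `G`-finiteness of a vector is `H`-finiteness: the `G`-span is finite-dimensional iff the `H`-span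
is. -/
theorem finiteDimensional_span_orbit_iff (hZ : ∀ z ∈ Z, ∃ c : ℂ, ρ z = c • LinearMap.id)
    (hGH : ∀ g : G, ∃ z ∈ Z, ∃ h ∈ H, g = z * h) (v : V) :
    FiniteDimensional ℂ (Submodule.span ℂ (Set.range fun g : G => ρ g v)) ↔
      FiniteDimensional ℂ (Submodule.span ℂ (Set.range fun h : H => ρ (h : G) v)) := by
  rw [span_orbit_eq_of_central ρ H Z hZ hGH v]

end Central

section Orbits

variable {X ι : Type*} [TopologicalSpace X]

/-- (A3) STEP 1: a cover of a compact space by pairwise disjoint non-empty open sets is finite. -/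
theorem finite_of_pairwise_disjoint_open_cover [CompactSpace X] (U : ι → Set X)
    (hopen : ∀ i, IsOpen (U i)) (hne : ∀ i, (U i).Nonempty)
    (hdisj : Pairwise fun i j => Disjoint (U i) (U j)) (hcov : ⋃ i, U i = Set.univ) :
    Finite ι := by
  obtain ⟨t, ht⟩ := isCompact_univ.elim_finite_subcover U hopen (by rw [hcov])
  have hall : ∀ j, j ∈ t := by
    intro j
    obtain ⟨x, hx⟩ := hne j
    obtain ⟨i, hi, hxi⟩ := Set.mem_iUnion₂.mp (ht (Set.mem_univ x))
    by_contra hj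
    have hij : i ≠ j := fun h => hj (h ▸ hi)
    exact Set.disjoint_left.mp (hdisj hij) hxi hx
  exact Finite.of_injective (fun j : ι => (⟨j, hall j⟩ : t)) fun a b h => by
    simpa using congrArg Subtype.val h

/-- Each member of a pairwise disjoint open cover is closed: its complement is the union of the
others. -/
theorem isClosed_of_pairwise_disjoint_open_cover (U : ι → Set X) (hopen : ∀ i, IsOpen (U i))
    (hdisj : Pairwise fun i j => Disjoint (U i) (U j)) (hcov : ⋃ i, U i = Set.univ) (i : ι) :
    IsClosed (U i) := by
  have hcompl : (U i)ᶜ = ⋃ j ∈ ({i}ᶜ : Set ι), U j := by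
    ext x
    constructor
    · intro hx
      have hx' : x ∈ ⋃ j, U j := by rw [hcov]; exact Set.mem_univ x
      obtain ⟨j, hj⟩ := Set.mem_iUnion.mp hx'
      have hji : j ≠ i := fun h => hx (h ▸ hj)
      exact Set.mem_iUnion₂.mpr ⟨j, hji, hj⟩
    · intro hx hxi
      obtain ⟨j, hji, hj⟩ := Set.mem_iUnion₂.mp hx
      exact Set.disjoint_left.mp (hdisj hji) hj hxi
  rw [← isOpen_compl_iff, hcompl]
  exact isOpen_biUnion fun j _ => hopen j

/-- Each member of a pairwise disjoint open cover of a compact space is compact. -/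
theorem isCompact_of_pairwise_disjoint_open_cover [CompactSpace X] (U : ι → Set X)
    (hopen : ∀ i, IsOpen (U i)) (hdisj : Pairwise fun i j => Disjoint (U i) (U j))
    (hcov : ⋃ i, U i = Set.univ) (i : ι) : IsCompact (U i) :=
  (isClosed_of_pairwise_disjoint_open_cover U hopen hdisj hcov i).isCompact

end Orbits

end Summit.Ventures.HodgeRepro2.T5AdmissibilityBookkeeping
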